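import Summits.NavierStokesRegularity.FluidComputer.PalasekTowerOvershootFirstHitting

/-!
# REGISTER v2.3′: the RATE form of first hitting — first crossing of a LINE by the speed maximum

Cell `ns-blowup`, seat `ns-blowup-fc-prover-3` (g3; prover; D-0074 GROUP C/E «BRIDGE SUPPORT»;
bears_on LADDER-NS N1, route `PalasekTowerBreakdown`, child crux items stmt-NavierStokesRegularity-19249
`HeredityAtOne` (upper stub `AprioriCeilingAt 1`, lower stub `ReadoutFloorsAt 1`), -19250 `HeredityFromTwo`,
parent -19178 `EpisodeInductionG` (line `fc-oneshot` v2.6), and the `first_episode` side of -19179 — supports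
only, nothing claimed or closed). LABEL: E–C typing (KERNEL analysis; every statement PROVED; no `Prop`
introduced; no unproved fact). WHAT THIS IS NOT: not Navier–Stokes evidence — nothing is constructed; no
stub is proved or refuted; the theorems are NECESSARY CONDITIONS every finite-energy classical solution
satisfies, now with a RATE. Companions: `PalasekTowerHandoverPressureRate.lean` (registered stages: every
hand-over, the first window, numbers of record) and `PalasekTowerOvershootPressureRate.lean` (the dual:
`AprioriCeilingAt k` from a rate bound on the pressure push).

## Why

The first-hitting calculus of this seat's g2 (`PalasekTowerWindowFirstHitting`, `…StageTightness`,
`…OvershootFirstHitting`) reads the momentum equation at the first instant a CONSTANT speed level is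
reached: there `0 ≤ ⟪u, ∂ₜu⟫`, so `ν|Du|²_F + ⟪u, ∇p⟫ ≤ ⟪u, f⟫` — a SIGN condition, rate `0`. But a
hand-over `j → j+1` must raise the global speed maximum from `≤ c₂ Y_j` to `≥ c₁ Y_{j+1}` inside a window
of length `τ_{j+1} − τ_j`, i.e. at MEAN RATE `(c₁ Y_{j+1} − c₂ Y_j)/(τ_{j+1} − τ_j)`. Replacing the
constant level by a LINE of slope `Λ` (the moving level `ℓ(t) = L₁ + Λ (t − T₁)⁺`) the same compactness
argument gives a first CROSSING of the line, and at the crossing point `⟪u, ∂ₜu⟫ ≥ Λ ‖u‖`, hence the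
HITTING INEQUALITY WITH DRIFT `ν|Du|²_F + ⟪u, ∇p⟫ + Λ‖u‖ ≤ ⟪u, f⟫`.

## What is proved

* §1 `HittingCalculus` with a moving level `L : ℝ → ℝ` (general classical solution on `[0, T]`):
  `inner_timeDeriv_ge_of_past_le` (`L(t₀) · L' ≤ ⟪u, ∂ₜu⟫` at a point dominated by `L` in the past and
  touching it now, `L'` the left derivative), `hitting_inequality_drift`, and the first hitting of a
  continuous moving level given a bounded super-level set (`exists_firstHitting_movingLevel_of_decay`).
* §2 `exists_lineCrossing_of_clayContinuation` — for ANY finite-energy classical solution on `[0, T]` with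
  Schwartz datum and Clay force (`ν > 0`): if `‖u‖ < L₁` on `[0, T₁] × ℝ³` and the level
  `L₁ + Λ (T₂ − T₁) > 0` is reached at `T₂`, the line is first crossed at some `t⋆ ∈ (T₁, T₂]`, at a
  global argmax `x⋆`, with `Λ‖u‖ ≤ ⟪u, ∂ₜu⟫` and `ν|Du|²_F + ⟪u, ∇p⟫ + Λ‖u‖ ≤ ⟪u, f⟫` there. UNCONDITIONAL
  (Tao class ⇒ uniform decay, as in p441906 `exists_firstHitting_of_clayContinuation`).

References: D. Gilbarg, N. Trudinger, *Elliptic PDE of second order*, §3.1 (conditions at a maximum)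
[cite: GilbargTrudinger2001, §3.1]; T. Tao, Anal. PDE 6 (2013), Cor. 11.1 (Tao class of finite-energy
classical solutions) [cite: Tao2011, Cor. 11.1]; S. Palasek, arXiv:2605.13827 §4 (the hand-over windows)
[cite: Palasek2026ElementaryModel, §4].
-/

noncomputable section

namespace Summit.NavierStokesRegularity.FluidComputer.PalasekTowerClayBridge

open Set MeasureTheory Filter Topology Function Real
open scoped ENNReal ContDiff NNReal InnerProductSpace RealInnerProductSpace
open Laplacian
open Literature.Analysis.FluidPDE

/-! ## §1 The hitting calculus with a moving level -/

namespace HittingCalculus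

variable {ν T : ℝ} {f u : ℝ → EuclideanSpace ℝ (Fin 3) → EuclideanSpace ℝ (Fin 3)}
  {p : ℝ → EuclideanSpace ℝ (Fin 3) → ℝ}

/-- **Temporal first-order condition with DRIFT.** If the speed at `x₀` is dominated by a moving level
`L` on `[0, t₀)` and touches it at `t₀ ∈ (0, T]`, and `L` has left derivative `L'` at `t₀`, then
`L(t₀) · L' ≤ ⟪u, ∂ₜu⟫(t₀, x₀)` (the function `‖u(·, x₀)‖² − L²` has a local maximum at `t₀` on `[0, t₀]`).
[folklore] -/
theorem inner_timeDeriv_ge_of_past_le (h : IsClassicalNSSolutionOn (Icc 0 T) ν f u p) {t₀ : ℝ}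
    (ht₀ : t₀ ∈ Ioc 0 T) {x₀ : EuclideanSpace ℝ (Fin 3)} {L : ℝ → ℝ} {L' : ℝ}
    (hL : HasDerivWithinAt L L' (Iic t₀) t₀)
    (hpast : ∀ t ∈ Ico 0 t₀, ‖u t x₀‖ ≤ L t) (heq : ‖u t₀ x₀‖ = L t₀) :
    L t₀ * L' ≤ ⟪u t₀ x₀, timeDerivWithin (Icc 0 T) u t₀ x₀⟫ := by
  have ht₀' : t₀ ∈ Icc 0 T := ⟨ht₀.1.le, ht₀.2⟩
  set D := timeDerivWithin (Icc 0 T) u t₀ x₀ with hD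
  have hline : HasDerivWithinAt (fun t => u t x₀) D (Icc 0 T) t₀ := by
    have h1 := (h.smooth_velocity.differentiableWithinAt_time ht₀' x₀).hasDerivWithinAt
    simpa only [hD, timeDerivWithin_apply] using h1
  have hsq : HasDerivWithinAt (fun t => ‖u t x₀‖ ^ 2) (2 * ⟪u t₀ x₀, D⟫) (Icc 0 t₀) t₀ :=
    hline.norm_sq.mono (Icc_subset_Icc_right ht₀.2)
  have hL2 : HasDerivWithinAt (fun t => L t * L t) (L' * L t₀ + L t₀ * L') (Icc 0 t₀) t₀ :=
    (hL.mul hL).mono fun t ht => ht.2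
  have hg : HasDerivWithinAt (fun t => ‖u t x₀‖ ^ 2 - L t * L t)
      (2 * ⟪u t₀ x₀, D⟫ - (L' * L t₀ + L t₀ * L')) (Icc 0 t₀) t₀ := hsq.sub hL2
  have hmax : IsLocalMaxOn (fun t => ‖u t x₀‖ ^ 2 - L t * L t) (Icc 0 t₀) t₀ := by
    refine eventually_nhdsWithin_of_forall fun t ht => ?_
    show ‖u t x₀‖ ^ 2 - L t * L t ≤ ‖u t₀ x₀‖ ^ 2 - L t₀ * L t₀
    have h0 : ‖u t₀ x₀‖ ^ 2 - L t₀ * L t₀ = 0 := by rw [heq]; ring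
    rw [h0]
    rcases ht.2.eq_or_lt with h' | h'
    · rw [h', heq]; nlinarith
    · have h1 : ‖u t x₀‖ ≤ L t := hpast t ⟨ht.1, h'⟩
      have h2 : 0 ≤ ‖u t x₀‖ := norm_nonneg _
      nlinarith
  have hy : (0 : ℝ) - t₀ ∈ posTangentConeAt (Icc 0 t₀) t₀ := by
    apply sub_mem_posTangentConeAt_of_segment_subset
    rw [segment_symm, segment_eq_Icc ht₀.1.le]
  have hle := hmax.hasFDerivWithinAt_nonpos hg.hasFDerivWithinAt hy
  simp only [ContinuousLinearMap.toSpanSingleton_apply, smul_eq_mul] at hle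
  have h0 : 0 < t₀ := ht₀.1
  by_contra hneg
  have hneg' : 2 * ⟪u t₀ x₀, D⟫ - (L' * L t₀ + L t₀ * L') < 0 := by
    have : ⟪u t₀ x₀, D⟫ < L t₀ * L' := lt_of_not_ge hneg
    nlinarith
  have : 0 < (0 - t₀) * (2 * ⟪u t₀ x₀, D⟫ - (L' * L t₀ + L t₀ * L')) :=
    mul_pos_of_neg_of_neg (by linarith) hneg'
  linarith

/-- **The hitting inequality WITH DRIFT.** At a point `(t₀, x₀)`, `t₀ ∈ (0, T]`, where `x₀` is a global
spatial argmax of the speed, the speed at `x₀` was dominated by the moving level `L` on `[0, t₀)` and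
equals `L(t₀)` now, `L` with left derivative `L'` at `t₀`:
`ν|Du|²_F + ⟪u, ∇p⟫ + L(t₀) L' ≤ ⟪u, f⟫` (`ν ≥ 0`; momentum equation, `⟪u, (u·∇)u⟫ = 0`,
`⟪u, Δu⟫ ≤ −|Du|²_F` at the maximum, and `⟪u, ∂ₜu⟫ ≥ L L'`). [cite: GilbargTrudinger2001, §3.1] -/
theorem hitting_inequality_drift (h : IsClassicalNSSolutionOn (Icc 0 T) ν f u p) (hν : 0 ≤ ν)
    {t₀ : ℝ} (ht₀ : t₀ ∈ Ioc 0 T) {x₀ : EuclideanSpace ℝ (Fin 3)}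
    (hmax : ∀ x, ‖u t₀ x‖ ≤ ‖u t₀ x₀‖) {L : ℝ → ℝ} {L' : ℝ}
    (hL : HasDerivWithinAt L L' (Iic t₀) t₀)
    (hpast : ∀ t ∈ Ico 0 t₀, ‖u t x₀‖ ≤ L t) (heq : ‖u t₀ x₀‖ = L t₀) :
    ν * frobeniusNormSq (fderiv ℝ (u t₀) x₀) + ⟪u t₀ x₀, gradient (p t₀) x₀⟫ + L t₀ * L' ≤
      ⟪u t₀ x₀, f t₀ x₀⟫ := by
  have ht₀' : t₀ ∈ Icc 0 T := ⟨ht₀.1.le, ht₀.2⟩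
  have hmom := h.momentum t₀ ht₀' x₀
  have hD : timeDerivWithin (Icc 0 T) u t₀ x₀ =
      ν • Δ (u t₀) x₀ - gradient (p t₀) x₀ + f t₀ x₀ - convect (u t₀) (u t₀) x₀ := by
    rw [← hmom]; abel
  have h1 := inner_timeDeriv_ge_of_past_le h ht₀ hL hpast heq
  have hconv : ⟪u t₀ x₀, convect (u t₀) (u t₀) x₀⟫ = 0 := by
    rw [convect_apply]; exact inner_fderiv_eq_zero_of_isMax h ht₀' hmax _
  rw [hD, inner_sub_right, inner_add_right, inner_sub_right, real_inner_smul_right, hconv] at h1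
  set U := u t₀ with hU
  have hC2 : ContDiff ℝ 2 U := (h.contDiff_velocity ht₀').of_le (by norm_cast)
  have hloc : IsLocalMax (fun x => ⟪U x, U x⟫) x₀ := by
    have h' : IsLocalMax (fun x => ‖U x‖ ^ 2) x₀ :=
      Filter.Eventually.of_forall fun x => pow_le_pow_left₀ (norm_nonneg _) (hmax x) 2
    simpa only [real_inner_self_eq_norm_sq] using h'
  have hΔ : (Δ fun y => ⟪U y, U y⟫) x₀ ≤ 0 := laplacian_nonpos_of_isLocalMax (hC2.inner ℝ hC2) hloc
  rw [laplacian_inner_self_eq hC2 x₀, real_inner_comm] at hΔ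
  have h3 : ν * ⟪U x₀, Δ U x₀⟫ ≤ ν * (- frobeniusNormSq (fderiv ℝ U x₀)) :=
    mul_le_mul_of_nonneg_left (by linarith) hν
  linarith

/-- Left-continuity against a moving level: `‖u t x‖ < L t` on `[0, t₀)` and `L` continuous from the left
at `t₀ ∈ (0, T]` within `[0, t₀]` give `‖u t₀ x‖ ≤ L t₀`. [folklore] -/
theorem norm_le_movingLevel_of_forall_lt (h : IsClassicalNSSolutionOn (Icc 0 T) ν f u p) {t₀ : ℝ}
    (ht₀ : t₀ ∈ Ioc 0 T) {L : ℝ → ℝ} (hLc : ContinuousWithinAt L (Ico 0 t₀) t₀)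
    (x : EuclideanSpace ℝ (Fin 3)) (hL : ∀ t ∈ Ico 0 t₀, ‖u t x‖ < L t) :
    ‖u t₀ x‖ ≤ L t₀ := by
  have ht₀' : t₀ ∈ Icc 0 T := ⟨ht₀.1.le, ht₀.2⟩
  have hcont : ContinuousWithinAt (fun t => ‖u t x‖) (Ico 0 t₀) t₀ :=
    ((h.smooth_velocity.differentiableWithinAt_time ht₀' x).continuousWithinAt.norm).mono
      fun t ht => ⟨ht.1, ht.2.le.trans ht₀.2⟩
  haveI hne : (𝓝[Ico 0 t₀] t₀).NeBot := by
    refine mem_closure_iff_nhdsWithin_neBot.1 ?_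
    rw [closure_Ico ht₀.1.ne]
    exact right_mem_Icc.2 ht₀.1.le
  exact le_of_tendsto_of_tendsto hcont hLc (eventually_nhdsWithin_of_forall fun t ht => (hL t ht).le)

/-- **First hitting of a MOVING level on a closed slab, given a bounded super-level set.** Let `L` be
continuous on `[0, T₂]`, `‖u‖ < L` on `[0, T₁] × ℝ³`, `L(T₂) ≤ ‖u(T₂, x)‖` for some `x` (`T₁ ≤ T₂ ≤ T`),
and `‖u t x‖ < L t` whenever `‖x‖ ≥ ρ`, `t ∈ [0, T₂]`. Then there are `t⋆ ∈ (T₁, T₂]` and `x⋆` with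
`‖u(t⋆, x⋆)‖ = L(t⋆)`, `‖u(t⋆, ·)‖ ≤ L(t⋆)` everywhere, `‖u t x‖ < L t` on `[0, t⋆) × ℝ³` (infimum of the
closed set of crossing times in the compact box `[0, T₂] × B̄(0, ρ)`). [folklore] -/
theorem exists_firstHitting_movingLevel_of_decay (h : IsClassicalNSSolutionOn (Icc 0 T) ν f u p)
    {L : ℝ → ℝ} {T₁ T₂ : ℝ} (hLc : ContinuousOn L (Icc 0 T₂))
    (hT₁ : T₁ ∈ Icc 0 T) (hT₁₂ : T₁ ≤ T₂) (hT₂ : T₂ ≤ T)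
    (hbefore : ∀ t ∈ Icc 0 T₁, ∀ x, ‖u t x‖ < L t) (hreach : ∃ x, L T₂ ≤ ‖u T₂ x‖)
    (hdec : ∃ ρ : ℝ, ∀ t ∈ Icc 0 T₂, ∀ x : EuclideanSpace ℝ (Fin 3), ρ ≤ ‖x‖ → ‖u t x‖ < L t) :
    ∃ t₀ ∈ Ioc T₁ T₂, ∃ x₀ : EuclideanSpace ℝ (Fin 3),
      ‖u t₀ x₀‖ = L t₀ ∧ (∀ x, ‖u t₀ x‖ ≤ L t₀) ∧ (∀ t ∈ Ico 0 t₀, ∀ x, ‖u t x‖ < L t) := by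
  obtain ⟨ρ, hρ⟩ := hdec
  have hT₂0 : 0 ≤ T₂ := hT₁.1.trans hT₁₂
  set Dm : Set (ℝ × EuclideanSpace ℝ (Fin 3)) :=
    Icc (0 : ℝ) T₂ ×ˢ Metric.closedBall (0 : EuclideanSpace ℝ (Fin 3)) ρ with hDdef
  have hDc : IsCompact Dm := isCompact_Icc.prod (isCompact_closedBall _ _)
  have hDcl : IsClosed Dm := isClosed_Icc.prod Metric.isClosed_closedBall
  have hsub : Dm ⊆ Icc (0 : ℝ) T ×ˢ (univ : Set (EuclideanSpace ℝ (Fin 3))) :=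
    prod_mono (Icc_subset_Icc_right hT₂) (subset_univ _)
  have hcontu : ContinuousOn (fun z : ℝ × EuclideanSpace ℝ (Fin 3) => ‖uncurry u z‖) Dm :=
    (h.smooth_velocity.continuousOn.mono hsub).norm
  have hcontL : ContinuousOn (fun z : ℝ × EuclideanSpace ℝ (Fin 3) => L z.1) Dm :=
    hLc.comp continuous_fst.continuousOn fun z hz => (mem_prod.1 hz).1
  have hcont : ContinuousOn (fun z : ℝ × EuclideanSpace ℝ (Fin 3) => ‖uncurry u z‖ - L z.1) Dm :=
    hcontu.sub hcontL
  set K : Set (ℝ × EuclideanSpace ℝ (Fin 3)) :=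
    Dm ∩ (fun z : ℝ × EuclideanSpace ℝ (Fin 3) => ‖uncurry u z‖ - L z.1) ⁻¹' Ici 0 with hKdef
  have hKcl : IsClosed K := hcont.preimage_isClosed_of_isClosed hDcl isClosed_Ici
  have hKc : IsCompact K := hDc.of_isClosed_subset hKcl inter_subset_left
  set A : Set ℝ := Prod.fst '' K with hAdef
  have hAcl : IsClosed A := (hKc.image continuous_fst).isClosed
  have hAbdd : BddBelow A := ⟨0, fun t ht => by
    obtain ⟨z, hz, rfl⟩ := ht
    exact hz.1.1.1⟩
  have hmemK : ∀ t ∈ Icc 0 T₂, ∀ x, L t ≤ ‖u t x‖ → (t, x) ∈ K := by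
    intro t ht x hx
    have hxρ : ‖x‖ ≤ ρ := by
      by_contra hlt
      exact absurd hx (not_le.2 (hρ t ht x (le_of_not_ge hlt)))
    refine ⟨⟨ht, ?_⟩, ?_⟩
    · rwa [Metric.mem_closedBall, dist_zero_right]
    · show 0 ≤ ‖uncurry u (t, x)‖ - L (t, x).1
      simp only [uncurry_apply_pair]
      linarith
  have hT₂A : T₂ ∈ A := by
    obtain ⟨x, hx⟩ := hreach
    exact ⟨(T₂, x), hmemK T₂ ⟨hT₂0, le_rfl⟩ x hx, rfl⟩
  have ht₀A : sInf A ∈ A := hAcl.csInf_mem ⟨T₂, hT₂A⟩ hAbdd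
  obtain ⟨⟨t', x₀⟩, hzK, hzt⟩ := ht₀A
  simp only at hzt
  have ht₀slab : t' ∈ Icc 0 T₂ := hzK.1.1
  have hx₀ : L t' ≤ ‖u t' x₀‖ := by
    have h2 : 0 ≤ ‖uncurry u (t', x₀)‖ - L (t', x₀).1 := hzK.2
    simp only [uncurry_apply_pair] at h2
    linarith
  have ht₀T₂ : t' ≤ T₂ := ht₀slab.2
  have hT₁t₀ : T₁ < t' := by
    by_contra hle
    exact absurd hx₀ (not_le.2 (hbefore t' ⟨ht₀slab.1, le_of_not_gt hle⟩ x₀))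
  have ht₀pos : 0 < t' := lt_of_le_of_lt hT₁.1 hT₁t₀
  have hstrict : ∀ t ∈ Ico 0 t', ∀ x, ‖u t x‖ < L t := by
    intro t ht x
    by_contra hge
    have htA : t ∈ A := ⟨(t, x), hmemK t ⟨ht.1, ht.2.le.trans ht₀T₂⟩ x (le_of_not_gt hge), rfl⟩
    have h1 : sInf A ≤ t := csInf_le hAbdd htA
    rw [← hzt] at h1
    exact absurd h1 (not_le.2 ht.2)
  have hLc' : ContinuousWithinAt L (Ico 0 t') t' :=
    (hLc t' ht₀slab).mono fun t ht => ⟨ht.1, ht.2.le.trans ht₀T₂⟩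
  have hle : ∀ x, ‖u t' x‖ ≤ L t' := fun x =>
    norm_le_movingLevel_of_forall_lt h ⟨ht₀pos, ht₀T₂.trans hT₂⟩ hLc' x fun t ht => hstrict t ht x
  exact ⟨t', ⟨hT₁t₀, ht₀T₂⟩, x₀, le_antisymm (hle x₀) hx₀, hle, hstrict⟩

end HittingCalculus

/-! ## §2 Any finite-energy classical Clay solution: first crossing of a line, unconditionally -/

/-- The moving level of §2–§5: the line of slope `Λ` starting at `L₁` at time `T₁`, constant `L₁`
before `T₁`: `ℓ(t) = L₁ + Λ · max (t − T₁) 0`. [folklore] -/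
theorem hasDerivAt_line {L₁ Λ T₁ t₀ : ℝ} (ht₀ : T₁ < t₀) :
    HasDerivAt (fun t => L₁ + Λ * max (t - T₁) 0) Λ t₀ := by
  have haff : HasDerivAt (fun t => L₁ + Λ * (t - T₁)) Λ t₀ := by
    have h1 : HasDerivAt (fun t => t - T₁) 1 t₀ := (hasDerivAt_id t₀).sub_const T₁
    have h2 := h1.const_mul Λ
    rw [mul_one] at h2
    exact h2.const_add L₁
  refine haff.congr_of_eventuallyEq ?_
  filter_upwards [Ioi_mem_nhds ht₀] with t ht
  rw [max_eq_left (sub_nonneg.2 (le_of_lt ht))]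

/-- The line is continuous. [folklore] -/
theorem continuous_line {L₁ Λ T₁ : ℝ} : Continuous (fun t : ℝ => L₁ + Λ * max (t - T₁) 0) := by
  fun_prop

/-- **FIRST CROSSING OF A LINE by the speed maximum of ANY finite-energy classical solution with
Schwartz datum and Clay force** (`ν > 0`). If `‖u‖ < L₁` on `[0, T₁] × ℝ³` (`L₁ > 0`) and the level
`L₁ + Λ (T₂ − T₁) > 0` is reached at `T₂` (`0 ≤ T₁ ≤ T₂ ≤ T`), then the line
`ℓ(t) = L₁ + Λ (t − T₁)⁺` is crossed for the FIRST time at some `t⋆ ∈ (T₁, T₂]`, at a global argmax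
`x⋆` of the speed: `‖u(t⋆, x⋆)‖ = ℓ(t⋆)`, `‖u‖ < ℓ` on `[0, t⋆) × ℝ³`, the speed at `x⋆` rises at least at
rate `Λ` INTO `t⋆` (`Λ‖u‖ ≤ ⟪u, ∂ₜu⟫`), and the HITTING INEQUALITY WITH DRIFT holds:
`ν|Du|²_F + ⟪u, ∇p⟫ + Λ‖u‖ ≤ ⟪u, f⟫` at `(t⋆, x⋆)`. Unconditional: the solution is in Tao's class, so its
super-level sets above `min L₁ (L₁ + Λ (T₂ − T₁)) > 0` are bounded uniformly in time
(`LocalEnergy.exists_radius_norm_lt`). [cite: Tao2011, Cor. 11.1] [cite: GilbargTrudinger2001, §3.1] -/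
theorem exists_lineCrossing_of_clayContinuation {ν T : ℝ} (hν : 0 < ν) (hT : 0 < T)
    {f u : ℝ → EuclideanSpace ℝ (Fin 3) → EuclideanSpace ℝ (Fin 3)}
    {p : ℝ → EuclideanSpace ℝ (Fin 3) → ℝ}
    (h : IsClassicalNSSolutionOn (Icc 0 T) ν f u p) (h₀ : HasRapidSpatialDecay (u 0))
    (hfs : IsSmoothOnHalfSpace f) (hfd : HasRapidSpaceTimeDecay f)
    (hE : ∃ C : ℝ≥0∞, C < ⊤ ∧ ∀ t ∈ Icc 0 T, ∫⁻ x, ‖u t x‖ₑ ^ 2 ≤ C)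
    {L₁ Λ T₁ T₂ : ℝ} (hT₁ : 0 ≤ T₁) (hT₁₂ : T₁ ≤ T₂) (hT₂ : T₂ ≤ T)
    (hL₁ : 0 < L₁) (hL₂ : 0 < L₁ + Λ * (T₂ - T₁))
    (hbefore : ∀ t ∈ Icc 0 T₁, ∀ x, ‖u t x‖ < L₁)
    (hreach : ∃ x, L₁ + Λ * (T₂ - T₁) ≤ ‖u T₂ x‖) :
    ∃ t₀ ∈ Ioc T₁ T₂, ∃ x₀ : EuclideanSpace ℝ (Fin 3),
      ‖u t₀ x₀‖ = L₁ + Λ * (t₀ - T₁) ∧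
      (∀ x, ‖u t₀ x‖ ≤ ‖u t₀ x₀‖) ∧
      (∀ t ∈ Ico 0 t₀, ∀ x, ‖u t x‖ < L₁ + Λ * max (t - T₁) 0) ∧
      Λ * ‖u t₀ x₀‖ ≤ ⟪u t₀ x₀, timeDerivWithin (Icc 0 T) u t₀ x₀⟫ ∧
      ν * frobeniusNormSq (fderiv ℝ (u t₀) x₀) + ⟪u t₀ x₀, gradient (p t₀) x₀⟫ + Λ * ‖u t₀ x₀‖ ≤
        ⟪u t₀ x₀, f t₀ x₀⟫ := by
  -- Tao's class: bounded speed and gradient on the slab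
  obtain ⟨C, hCt, hC⟩ := hE
  have hE' : ∃ C : ℝ≥0, ∀ t ∈ Icc 0 T, ∫⁻ x, ‖u t x‖ₑ ^ 2 ≤ C :=
    ⟨C.toNNReal, fun t ht => (hC t ht).trans (ENNReal.coe_toNNReal hCt.ne).ge⟩
  have hTao : HasBoundedSobolevNormsOn (Icc 0 T) u :=
    h.hasBoundedSobolevNormsOn_of_clayForce hν hT hE' h₀ hfs hfd
  have hsm : ∀ t ∈ Icc 0 T, ContDiff ℝ ∞ (u t) := fun t ht => h.contDiff_velocity ht
  obtain ⟨M, -, hM⟩ := hTao.exists_forall_norm_iteratedFDeriv_le hsm 0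
  obtain ⟨B, -, hB⟩ := hTao.exists_forall_norm_iteratedFDeriv_le hsm 1
  have hM' : ∀ t ∈ Icc 0 T, ∀ x, ‖u t x‖ ≤ M := fun t ht x => by simpa using hM t ht x
  have hB' : ∀ t ∈ Icc 0 T, ∀ x, ‖fderiv ℝ (u t) x‖ ≤ B := fun t ht x => by
    have h1 := hB t ht x
    rwa [← norm_iteratedFDeriv_fderiv (n := 0), norm_iteratedFDeriv_zero] at h1
  -- the moving level and its positive floor on `[0, T₂]`
  set ℓ : ℝ → ℝ := fun t => L₁ + Λ * max (t - T₁) 0 with hℓ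
  set m : ℝ := min L₁ (L₁ + Λ * (T₂ - T₁)) with hm
  have hm0 : 0 < m := lt_min hL₁ hL₂
  have hℓm : ∀ t ∈ Icc 0 T₂, m ≤ ℓ t := by
    intro t ht
    have hmax0 : 0 ≤ max (t - T₁) 0 := le_max_right _ _
    have hmax1 : max (t - T₁) 0 ≤ T₂ - T₁ := max_le (by linarith [ht.2]) (by linarith)
    rcases le_or_gt 0 Λ with hΛ | hΛ
    · calc m ≤ L₁ := min_le_left _ _
        _ ≤ ℓ t := by simp only [hℓ]; nlinarith
    · calc m ≤ L₁ + Λ * (T₂ - T₁) := min_le_right _ _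
        _ ≤ ℓ t := by simp only [hℓ]; nlinarith
  have hdecm := LocalEnergy.exists_radius_norm_lt hν hT h hfs hfd hM' hB' hE' hm0
  have hdec : ∃ ρ : ℝ, ∀ t ∈ Icc 0 T₂, ∀ x : EuclideanSpace ℝ (Fin 3), ρ ≤ ‖x‖ → ‖u t x‖ < ℓ t := by
    obtain ⟨ρ, hρ⟩ := hdecm
    exact ⟨ρ, fun t ht x hx => lt_of_lt_of_le (hρ t ⟨ht.1, ht.2.trans hT₂⟩ x hx) (hℓm t ht)⟩
  have hbefore' : ∀ t ∈ Icc 0 T₁, ∀ x, ‖u t x‖ < ℓ t := by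
    intro t ht x
    have : ℓ t = L₁ := by
      simp only [hℓ]
      rw [max_eq_right (by linarith [ht.2]), mul_zero, add_zero]
    rw [this]; exact hbefore t ht x
  have hreach' : ∃ x, ℓ T₂ ≤ ‖u T₂ x‖ := by
    obtain ⟨x, hx⟩ := hreach
    refine ⟨x, ?_⟩
    have : ℓ T₂ = L₁ + Λ * (T₂ - T₁) := by
      simp only [hℓ]; rw [max_eq_left (sub_nonneg.2 hT₁₂)]
    rw [this]; exact hx
  have hℓc : ContinuousOn ℓ (Icc 0 T₂) := continuous_line.continuousOn
  obtain ⟨t₀, ht₀, x₀, heq, hle, hstrict⟩ :=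
    HittingCalculus.exists_firstHitting_movingLevel_of_decay h hℓc
      ⟨hT₁, hT₁₂.trans hT₂⟩ hT₁₂ hT₂ hbefore' hreach' hdec
  have ht₀' : t₀ ∈ Ioc 0 T := ⟨lt_of_le_of_lt hT₁ ht₀.1, ht₀.2.trans hT₂⟩
  have hℓt₀ : ℓ t₀ = L₁ + Λ * (t₀ - T₁) := by
    simp only [hℓ]; rw [max_eq_left (sub_nonneg.2 ht₀.1.le)]
  have hmax : ∀ x, ‖u t₀ x‖ ≤ ‖u t₀ x₀‖ := fun x => (hle x).trans heq.ge
  have hpast : ∀ t ∈ Ico 0 t₀, ‖u t x₀‖ ≤ ℓ t := fun t ht => (hstrict t ht x₀).le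
  have hderiv : HasDerivWithinAt ℓ Λ (Iic t₀) t₀ := (hasDerivAt_line ht₀.1).hasDerivWithinAt
  have htime := HittingCalculus.inner_timeDeriv_ge_of_past_le h ht₀' hderiv hpast heq
  have hineq := HittingCalculus.hitting_inequality_drift h hν.le ht₀' hmax hderiv hpast heq
  rw [mul_comm (ℓ t₀) Λ, ← heq] at htime hineq
  exact ⟨t₀, ht₀, x₀, heq.trans hℓt₀, hmax, hstrict, htime, hineq⟩


end Summit.NavierStokesRegularity.FluidComputer.PalasekTowerClayBridge

end
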